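import Literature.NumberTheory.IwasawaTheory.ClassicalMuVanishesKurodaTower
import Literature.NumberTheory.SerreUniformity.SplitCartan
import Mathlib.GroupTheory.Perm.Cycle.Type
import HarnessLib

set_option autoImplicit false

/-!
# `μ = 0` for `ℚ(E[3])_cyc` from a split-Cartan mod-3 image: the bridge from a faithful matrix representation
# `Gal(L/ℚ) ↪ M₂(𝔽₃)` with values in `C_s⁺(3)` to the D₄ Kuroda census form

Topic `NumberTheory/IwasawaTheory` (namespace = path).  THEOREM-ONLY file (no definition, no named fact, no `sorry`);
literature seat `bsd-potss-conjA-anchor` g11 (supports stmt-BirchSwinnertonDyer-19386 / 19413; closes nothing).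

`ClassicalMuVanishesKurodaTower.classicalMuVanishes_of_isCyclotomic_of_kuroda_rat` asks a row for ELEMENTS `z, b, g` of
`Gal(L/ℚ)` with their `D₄` relations.  Here those are DERIVED from what a mod-3 Galois-image computation delivers, in the
vocabulary of `SerreUniformity.splitCartanNormalizer` / `HasSplitCartanNormalizerModPImage` (matrices `(a 0; 0 d)`,
`(0 b; c 0)` over `𝔽₃`):

* `classicalMuVanishes_of_isCyclotomic_of_splitCartanNormalizer_three` — `L/ℚ` finite Galois, `ρ : Gal(L/ℚ) →* M₂(𝔽₃)`
  an INJECTIVE monoid hom with `ρ(g) ∈ splitCartanNormalizer 3` for all `g` (any basis), `K ⊆ L` with `[K:ℚ] = 4` whose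
  fixing subgroup contains some `s` with `ρ s ≠ ±1` (for `K = ℚ(P)`, `P ∈ E[3] ∖ 0`: the non-trivial element of
  `Stab(P)`, which is not `−1` because it fixes `P`).  Then, under `ferreroWashington1979_classicalMuVanishes` alone,
  «`μ = 0` for every cyclotomic `ℤ_3`-extension of `K`» ⇒ «`μ = 0` for every cyclotomic `ℤ_3`-extension of `L`».
  Proof: either `Gal(L/ℚ)` is commutative (then `L/ℚ` is abelian: Ferrero–Washington directly), or for a non-commuting
  pair `a, c` the commutator `z = [a, c]` has `ρ z = −1` (in `C_s⁺(3) ≅ D₄` every commutator is `±1` — `decide` on the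
  eight matrices), `z` is central, all commutators lie in `⟨z⟩`, every element has order dividing `4` (so `3 ∤ [L:ℚ]`),
  `#Gal(L/ℚ) ≤ 8` forces `[L:K] = 2` and `K = L^{⟨s⟩}`, `s` is not central (the centre of `C_s⁺(3)` is `{±1}`), and a
  `t` with `ts ≠ st` conjugates `s` to `zs`; now apply the `D₄` Kuroda form.
* `classicalMuVanishes_of_isCyclotomic_of_splitCartanNormalizer_three_fixedField` — the same with the quartic field GIVEN as
  `L^{⟨s⟩}` for an involution `s` with `ρ s ≠ ±1` (no degree hypothesis; the form fed by `ℚ(E[3])`-level statements).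
* `classicalMuVanishes_of_isCyclotomic_of_forall_commute` — the abelian case by itself.

References: [Serre1972, §2.2 (split Cartan subgroups and their normalisers)]; [BiluParentRebolledo2013, §1];
[Lemmermeyer1994, §1]; [Washington1997, §7.5, §13.1].
-/

noncomputable section

open scoped NumberField

open Field IntermediateField Literature.NumberTheory.EllipticCurves Literature.NumberTheory.SerreUniformity

namespace Literature.NumberTheory.IwasawaTheory

/-! ### §0 Finite facts about `C_s⁺(3) = {(a 0; 0 d), (0 b; c 0)} ⊂ GL₂(𝔽₃)` (by `decide`) -/

section Matrices

/-- An element of `splitCartanNormalizer 3` is `(a 0; 0 d)` with `ad ≠ 0` or `(0 b; c 0)` with `bc ≠ 0`. [folklore] -/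
private theorem shape_of_mem_splitCartanNormalizer {M : Matrix (Fin 2) (Fin 2) (ZMod 3)}
    (hM : M ∈ splitCartanNormalizer 3) :
    (∃ a d : ZMod 3, a * d ≠ 0 ∧ M = !![a, 0; 0, d]) ∨ (∃ b c : ZMod 3, b * c ≠ 0 ∧ M = !![0, b; c, 0]) := by
  obtain ⟨hdet, h | h⟩ := hM
  · refine Or.inl ⟨M 0 0, M 1 1, ?_, ?_⟩
    · simpa only [Matrix.det_fin_two, h.1, h.2, mul_zero, sub_zero] using hdet
    · exact Matrix.ext fun i j => by fin_cases i <;> fin_cases j <;> simp [h.1, h.2]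
  · refine Or.inr ⟨M 0 1, M 1 0, ?_, ?_⟩
    · have h' : -(M 0 1 * M 1 0) ≠ 0 := by
        simpa only [Matrix.det_fin_two, h.1, h.2, zero_mul, zero_sub] using hdet
      exact neg_ne_zero.mp h'
    · exact Matrix.ext fun i j => by fin_cases i <;> fin_cases j <;> simp [h.1, h.2]

/-- Diagonal matrices commute (the split Cartan `C_s(3)` is abelian). [folklore] -/
private theorem dd_comm : ∀ a d a' d' : ZMod 3,
    (!![a, 0; 0, d] : Matrix (Fin 2) (Fin 2) (ZMod 3)) * !![a', 0; 0, d'] = !![a', 0; 0, d'] * !![a, 0; 0, d] := by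
  decide

/-- `diag · antidiag = ± antidiag · diag` in `C_s⁺(3)`. [folklore] -/
private theorem da_comm_or : ∀ a d b c : ZMod 3, a * d ≠ 0 → b * c ≠ 0 →
    (!![a, 0; 0, d] : Matrix (Fin 2) (Fin 2) (ZMod 3)) * !![0, b; c, 0] = !![0, b; c, 0] * !![a, 0; 0, d] ∨
      (!![a, 0; 0, d] : Matrix (Fin 2) (Fin 2) (ZMod 3)) * !![0, b; c, 0] = -(!![0, b; c, 0] * !![a, 0; 0, d]) := by
  decide

/-- `antidiag · diag = ± diag · antidiag` in `C_s⁺(3)`. [folklore] -/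
private theorem ad_comm_or : ∀ b c a d : ZMod 3, b * c ≠ 0 → a * d ≠ 0 →
    (!![0, b; c, 0] : Matrix (Fin 2) (Fin 2) (ZMod 3)) * !![a, 0; 0, d] = !![a, 0; 0, d] * !![0, b; c, 0] ∨
      (!![0, b; c, 0] : Matrix (Fin 2) (Fin 2) (ZMod 3)) * !![a, 0; 0, d] = -(!![a, 0; 0, d] * !![0, b; c, 0]) := by
  decide

/-- Two antidiagonal elements of `C_s⁺(3)` commute up to sign. [folklore] -/
private theorem aa_comm_or : ∀ b c b' c' : ZMod 3, b * c ≠ 0 → b' * c' ≠ 0 →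
    (!![0, b; c, 0] : Matrix (Fin 2) (Fin 2) (ZMod 3)) * !![0, b'; c', 0] = !![0, b'; c', 0] * !![0, b; c, 0] ∨
      (!![0, b; c, 0] : Matrix (Fin 2) (Fin 2) (ZMod 3)) * !![0, b'; c', 0] = -(!![0, b'; c', 0] * !![0, b; c, 0]) := by
  decide

/-- In `C_s⁺(3)` two elements commute up to the sign `−1` (every commutator is `±1`). [folklore] -/
private theorem mul_eq_or_eq_neg_of_mem {A C : Matrix (Fin 2) (Fin 2) (ZMod 3)} (hA : A ∈ splitCartanNormalizer 3)
    (hC : C ∈ splitCartanNormalizer 3) : A * C = C * A ∨ A * C = -(C * A) := by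
  rcases shape_of_mem_splitCartanNormalizer hA with ⟨a, d, had, rfl⟩ | ⟨b, c, hbc, rfl⟩ <;>
    rcases shape_of_mem_splitCartanNormalizer hC with ⟨a', d', had', rfl⟩ | ⟨b', c', hbc', rfl⟩
  · exact Or.inl (dd_comm a d a' d')
  · exact da_comm_or a d b' c' had hbc'
  · exact ad_comm_or b c a' d' hbc had'
  · exact aa_comm_or b c b' c' hbc hbc'

/-- `diag(a,d)⁴ = 1` over `𝔽₃`. [folklore] -/
private theorem d_pow_four : ∀ a d : ZMod 3, a * d ≠ 0 → (!![a, 0; 0, d] : Matrix (Fin 2) (Fin 2) (ZMod 3)) ^ 4 = 1 := by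
  decide

/-- An invertible antidiagonal matrix over `𝔽₃` has order dividing `4`. [folklore] -/
private theorem a_pow_four : ∀ b c : ZMod 3, b * c ≠ 0 → (!![0, b; c, 0] : Matrix (Fin 2) (Fin 2) (ZMod 3)) ^ 4 = 1 := by
  decide

/-- Every element of `C_s⁺(3)` has order dividing `4`. [folklore] -/
private theorem pow_four_eq_one_of_mem {A : Matrix (Fin 2) (Fin 2) (ZMod 3)} (hA : A ∈ splitCartanNormalizer 3) :
    A ^ 4 = 1 := by
  rcases shape_of_mem_splitCartanNormalizer hA with ⟨a, d, had, rfl⟩ | ⟨b, c, hbc, rfl⟩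
  exacts [d_pow_four a d had, a_pow_four b c hbc]

/-- A diagonal element of `C_s⁺(3)` commuting with an antidiagonal one is `±1`. [folklore] -/
private theorem a_d_comm_imp : ∀ b c x y : ZMod 3, b * c ≠ 0 → x * y ≠ 0 →
    (!![0, b; c, 0] : Matrix (Fin 2) (Fin 2) (ZMod 3)) * !![x, 0; 0, y] = !![x, 0; 0, y] * !![0, b; c, 0] →
    (!![x, 0; 0, y] : Matrix (Fin 2) (Fin 2) (ZMod 3)) = 1 ∨ (!![x, 0; 0, y] : Matrix (Fin 2) (Fin 2) (ZMod 3)) = -1 := by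
  decide

/-- Two commuting antidiagonal elements of `C_s⁺(3)` are equal up to sign. [folklore] -/
private theorem a_a_comm_imp : ∀ b c b' c' : ZMod 3, b * c ≠ 0 → b' * c' ≠ 0 →
    (!![0, b; c, 0] : Matrix (Fin 2) (Fin 2) (ZMod 3)) * !![0, b'; c', 0] = !![0, b'; c', 0] * !![0, b; c, 0] →
    (!![0, b'; c', 0] : Matrix (Fin 2) (Fin 2) (ZMod 3)) = !![0, b; c, 0] ∨
      (!![0, b'; c', 0] : Matrix (Fin 2) (Fin 2) (ZMod 3)) = -!![0, b; c, 0] := by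
  decide

/-- The centre of `C_s⁺(3)` is `{±1}`: an element `S ≠ ±1` commuting with `A` and `C` forces `AC = CA`. [folklore] -/
private theorem comm_of_comm_of_comm {S A C : Matrix (Fin 2) (Fin 2) (ZMod 3)} (hS : S ∈ splitCartanNormalizer 3)
    (hA : A ∈ splitCartanNormalizer 3) (hC : C ∈ splitCartanNormalizer 3) (hS1 : S ≠ 1) (hS2 : S ≠ -1)
    (hSA : S * A = A * S) (hSC : S * C = C * S) : A * C = C * A := by
  rcases shape_of_mem_splitCartanNormalizer hS with ⟨x, y, hxy, rfl⟩ | ⟨b, c, hbc, rfl⟩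
  · rcases shape_of_mem_splitCartanNormalizer hA with ⟨a, d, -, rfl⟩ | ⟨b', c', hbc', rfl⟩
    · rcases shape_of_mem_splitCartanNormalizer hC with ⟨a', d', -, rfl⟩ | ⟨b'', c'', hbc'', rfl⟩
      · exact dd_comm a d a' d'
      · rcases a_d_comm_imp b'' c'' x y hbc'' hxy hSC.symm with h | h
        exacts [absurd h hS1, absurd h hS2]
    · rcases a_d_comm_imp b' c' x y hbc' hxy hSA.symm with h | h
      exacts [absurd h hS1, absurd h hS2]
  · have key : ∀ X : Matrix (Fin 2) (Fin 2) (ZMod 3), X ∈ splitCartanNormalizer 3 →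
        !![0, b; c, 0] * X = X * !![0, b; c, 0] →
        X = 1 ∨ X = -1 ∨ X = !![0, b; c, 0] ∨ X = -!![0, b; c, 0] := by
      intro X hX hSX
      rcases shape_of_mem_splitCartanNormalizer hX with ⟨x, y, hxy, rfl⟩ | ⟨b', c', hbc', rfl⟩
      · rcases a_d_comm_imp b c x y hbc hxy hSX with h | h
        · exact Or.inl h
        · exact Or.inr (Or.inl h)
      · rcases a_a_comm_imp b c b' c' hbc hbc' hSX with h | h
        · exact Or.inr (Or.inr (Or.inl h))
        · exact Or.inr (Or.inr (Or.inr h))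
    rcases key A hA hSA with rfl | rfl | rfl | rfl <;> rcases key C hC hSC with rfl | rfl | rfl | rfl <;>
      simp only [Matrix.mul_one, Matrix.one_mul, Matrix.mul_neg, Matrix.neg_mul, neg_neg]

/-- The diagonal elements of `C_s⁺(3)` among the eight matrices of `C_s⁺(3)`. [folklore] -/
private theorem d_mem_eight : ∀ a d : ZMod 3, a * d ≠ 0 → (!![a, 0; 0, d] : Matrix (Fin 2) (Fin 2) (ZMod 3)) ∈
    ({1, -1, !![1, 0; 0, 2], !![2, 0; 0, 1], !![0, 1; 1, 0], !![0, 2; 2, 0], !![0, 1; 2, 0], !![0, 2; 1, 0]} :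
      Finset (Matrix (Fin 2) (Fin 2) (ZMod 3))) := by
  decide

/-- The antidiagonal elements of `C_s⁺(3)` among the eight matrices of `C_s⁺(3)`. [folklore] -/
private theorem a_mem_eight : ∀ b c : ZMod 3, b * c ≠ 0 → (!![0, b; c, 0] : Matrix (Fin 2) (Fin 2) (ZMod 3)) ∈
    ({1, -1, !![1, 0; 0, 2], !![2, 0; 0, 1], !![0, 1; 1, 0], !![0, 2; 2, 0], !![0, 1; 2, 0], !![0, 2; 1, 0]} :
      Finset (Matrix (Fin 2) (Fin 2) (ZMod 3))) := by
  decide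

/-- `#C_s⁺(3) = 8`: a group with a faithful representation into `C_s⁺(3)` has at most `8` elements. [folklore] -/
private theorem natCard_le_eight {G : Type*} [Group G] [Finite G] (ρ : G →* Matrix (Fin 2) (Fin 2) (ZMod 3))
    (hρ : Function.Injective ρ) (himg : ∀ g, ρ g ∈ splitCartanNormalizer 3) : Nat.card G ≤ 8 := by
  classical
  haveI := Fintype.ofFinite G
  have hmaps : Set.MapsTo ρ ↑(Finset.univ : Finset G)
      ↑({1, -1, !![1, 0; 0, 2], !![2, 0; 0, 1], !![0, 1; 1, 0], !![0, 2; 2, 0], !![0, 1; 2, 0], !![0, 2; 1, 0]} :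
        Finset (Matrix (Fin 2) (Fin 2) (ZMod 3))) := by
    intro g _
    rw [Finset.mem_coe]
    rcases shape_of_mem_splitCartanNormalizer (himg g) with ⟨a, d, had, h⟩ | ⟨b, c, hbc, h⟩
    · rw [h]; exact d_mem_eight a d had
    · rw [h]; exact a_mem_eight b c hbc
  have h1 := Finset.card_le_card_of_injOn ρ hmaps hρ.injOn
  have h2 : ({1, -1, !![1, 0; 0, 2], !![2, 0; 0, 1], !![0, 1; 1, 0], !![0, 2; 2, 0], !![0, 1; 2, 0], !![0, 2; 1, 0]} :
      Finset (Matrix (Fin 2) (Fin 2) (ZMod 3))).card ≤ 8 := by decide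
  rw [Nat.card_eq_fintype_card, ← Finset.card_univ]
  exact h1.trans h2

end Matrices

/-! ### §1 The bridge -/

/-- **Abelian image.**  If `Gal(L/ℚ)` is commutative then `L/ℚ` is abelian and Ferrero–Washington applies to `L` itself:
`μ = 0` for every cyclotomic `ℤ_p`-extension of `L` (e.g. mod-`3` image inside the split Cartan itself, or cyclic).
[cite: Washington1997, §7.5 (Ferrero–Washington for abelian fields)] -/
theorem classicalMuVanishes_of_isCyclotomic_of_forall_commute (hFW : ferreroWashington1979_classicalMuVanishes)
    {p : ℕ} [Fact p.Prime] (L : Type) [Field L] [NumberField L] [IsGalois ℚ L]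
    (hab : ∀ a c : L ≃ₐ[ℚ] L, a * c = c * a) (κL : ZpExtension L p) (hκL : κL.IsCyclotomic) :
    ClassicalMuVanishes κL := by
  haveI : IsAbelianGalois ℚ L := { is_comm := ⟨hab⟩ }
  exact hFW L p κL hκL

/-- **`μ = 0` for the cyclotomic `ℤ_3`-tower of `L` from a faithful `C_s⁺(3)`-valued representation of `Gal(L/ℚ)` and
`μ(L^{⟨s⟩}) = 0`, modulo Ferrero–Washington alone — fixed-field form.**  `L/ℚ` finite Galois; `ρ : Gal(L/ℚ) →* M₂(𝔽₃)`
injective with every `ρ(g)` in `splitCartanNormalizer 3` (any basis); `s ∈ Gal(L/ℚ)` an involution with `ρ s ≠ 1, −1` (for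
`L = ℚ(E[3])`: the restriction of a `τ ∈ Γ_ℚ` with `τ² = 1` on `E[3]`, `τ ≠ 1, −1` on `E[3]`; `L^{⟨s⟩} = ℚ(P)` when the image is
all of `C_s⁺(3)`).  If `μ = 0` holds for every cyclotomic `ℤ_3`-extension of `L^{⟨s⟩}`, then — under
`ferreroWashington1979_classicalMuVanishes` — for every cyclotomic `ℤ_3`-extension of `L`.  Road: `Gal(L/ℚ)` commutative ⇒
Ferrero–Washington on `L`; otherwise `z = [a, c]` has `ρ z = −1`, is a central involution with all commutators in `⟨z⟩`,
`g⁴ = 1` for all `g` (so `3 ∤ [L:ℚ]`), and `s` is conjugate to `zs` (the centre of `C_s⁺(3)` is `{±1}`): the `D₄` Kuroda form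
`classicalMuVanishes_of_isCyclotomic_of_kuroda_rat`. [cite: Serre1972, §2.2 (split Cartan subgroups, normalisers)]
[cite: Lemmermeyer1994, §1 (Kuroda's class number formula, odd part)] [cite: Washington1997, §7.5, §13.1] -/
theorem classicalMuVanishes_of_isCyclotomic_of_splitCartanNormalizer_three_fixedField
    (hFW : ferreroWashington1979_classicalMuVanishes)
    (L : Type) [Field L] [NumberField L] [IsGalois ℚ L]
    (ρ : (L ≃ₐ[ℚ] L) →* Matrix (Fin 2) (Fin 2) (ZMod 3)) (hρ : Function.Injective ρ)
    (himg : ∀ g, ρ g ∈ splitCartanNormalizer 3)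
    {s : L ≃ₐ[ℚ] L} (hss : s * s = 1) (hs1 : ρ s ≠ 1) (hs2 : ρ s ≠ -1)
    (hμ : ∀ κE : ZpExtension ↥(fixedField (Subgroup.zpowers s)) 3, κE.IsCyclotomic → ClassicalMuVanishes κE)
    (κL : ZpExtension L 3) (hκL : κL.IsCyclotomic) : ClassicalMuVanishes κL := by
  classical
  have hinv : ∀ g : L ≃ₐ[ℚ] L, ρ g * ρ g⁻¹ = 1 := fun g => by rw [← map_mul, mul_inv_cancel, map_one]
  -- commutator dichotomy in `G`
  have hdich : ∀ a c : L ≃ₐ[ℚ] L, a * c = c * a ∨ ρ (a * c) = -ρ (c * a) := by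
    intro a c
    rcases mul_eq_or_eq_neg_of_mem (himg a) (himg c) with h | h
    · left; apply hρ; rw [map_mul, map_mul, h]
    · right; rw [map_mul, map_mul, h]
  by_cases hab : ∀ a c : L ≃ₐ[ℚ] L, a * c = c * a
  · exact classicalMuVanishes_of_isCyclotomic_of_forall_commute hFW L hab κL hκL
  push Not at hab
  obtain ⟨a, c, hac⟩ := hab
  have hzρ : ρ (a * c) = -ρ (c * a) := (hdich a c).resolve_left hac
  obtain ⟨z, hz⟩ : ∃ z : L ≃ₐ[ℚ] L, z = a * c * a⁻¹ * c⁻¹ := ⟨_, rfl⟩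
  -- `ρ z = -1`: a central involution, and every commutator lies in `⟨z⟩`
  have e1 : ρ z * ρ (c * a) = ρ (a * c) := by
    rw [← map_mul, hz]; congr 1; group
  have hρz : ρ z = -1 := by
    calc ρ z = ρ z * (ρ (c * a) * ρ (c * a)⁻¹) := by rw [hinv, mul_one]
      _ = ρ (a * c) * ρ (c * a)⁻¹ := by rw [← mul_assoc, e1]
      _ = -1 := by rw [hzρ, neg_mul, hinv]
  have hzc : ∀ g : L ≃ₐ[ℚ] L, g * z = z * g := fun g =>
    hρ (by rw [map_mul, map_mul, hρz, mul_neg, mul_one, neg_mul, one_mul])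
  have hzz : z * z = 1 := hρ (by rw [map_mul, hρz, neg_mul_neg, one_mul, map_one])
  have hcomm : ∀ a' c' : L ≃ₐ[ℚ] L, a' * c' * a'⁻¹ * c'⁻¹ ∈ Subgroup.zpowers z := by
    intro a' c'
    rcases hdich a' c' with h | h
    · have h' : a' * c' * a'⁻¹ * c'⁻¹ = 1 := by rw [h]; group
      rw [h']
      exact one_mem _
    · have h2 : a' * c' = z * (c' * a') := hρ (by rw [h, map_mul ρ z (c' * a'), hρz, neg_mul, one_mul])
      have h' : a' * c' * a'⁻¹ * c'⁻¹ = z := by rw [h2]; group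
      rw [h']
      exact Subgroup.mem_zpowers z
  -- orders divide `4`, so `3 ∤ [L : ℚ]`
  have hp : ¬ 3 ∣ Module.finrank ℚ L := by
    rw [← IsGalois.card_aut_eq_finrank ℚ L]
    intro h3
    obtain ⟨g, hg⟩ := exists_prime_orderOf_dvd_card' 3 h3
    have h4 : g ^ 4 = 1 := hρ (by rw [map_pow, map_one]; exact pow_four_eq_one_of_mem (himg g))
    have hdvd : orderOf g ∣ 4 := orderOf_dvd_of_pow_eq_one h4
    rw [hg] at hdvd
    exact absurd hdvd (by decide)
  -- `s` is not central (the centre of `C_s⁺(3)` is `{±1}`): some `t` conjugates `s` to `z s`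
  have hsnc : ∃ t : L ≃ₐ[ℚ] L, t * s ≠ s * t := by
    by_contra hall
    push Not at hall
    apply hac
    apply hρ
    rw [map_mul, map_mul]
    exact comm_of_comm_of_comm (himg s) (himg a) (himg c) hs1 hs2 (by rw [← map_mul, ← map_mul, hall a])
      (by rw [← map_mul, ← map_mul, hall c])
  obtain ⟨t, ht⟩ := hsnc
  have hconj : ∃ g : L ≃ₐ[ℚ] L, g * s * g⁻¹ = z * s := by
    refine ⟨t, ?_⟩
    have h := (hdich t s).resolve_left ht
    have h2 : t * s = z * (s * t) := hρ (by rw [h, map_mul ρ z (s * t), hρz, neg_mul, one_mul])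
    rw [h2]; group
  have hzs : z * s = s * z := (hzc s).symm
  exact classicalMuVanishes_of_isCyclotomic_of_kuroda_rat hFW (by decide) L hp hzz hss hzs hconj hcomm hμ κL hκL

/-- **Degree form.**  As `…_fixedField`, with the field given as an intermediate field `K` of degree `4` over `ℚ` whose fixing
group contains `s` (for `K = ℚ(P)`: the involution of `Stab(P)`); then `#Gal ≤ 8 = #C_s⁺(3)` forces `[L:K] = 2`, `s² = 1` and
`K = L^{⟨s⟩}`. [cite: Serre1972, §2.2 (split Cartan subgroups, normalisers)]
[cite: Lemmermeyer1994, §1 (Kuroda's class number formula, odd part)] [cite: Washington1997, §7.5, §13.1] -/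
theorem classicalMuVanishes_of_isCyclotomic_of_splitCartanNormalizer_three
    (hFW : ferreroWashington1979_classicalMuVanishes)
    (L : Type) [Field L] [NumberField L] [IsGalois ℚ L]
    (ρ : (L ≃ₐ[ℚ] L) →* Matrix (Fin 2) (Fin 2) (ZMod 3)) (hρ : Function.Injective ρ)
    (himg : ∀ g, ρ g ∈ splitCartanNormalizer 3)
    (K : IntermediateField ℚ L) (hK4 : Module.finrank ℚ ↥K = 4)
    {s : L ≃ₐ[ℚ] L} (hsK : s ∈ K.fixingSubgroup) (hs1 : ρ s ≠ 1) (hs2 : ρ s ≠ -1)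
    (hμ : ∀ κE : ZpExtension ↥K 3, κE.IsCyclotomic → ClassicalMuVanishes κE)
    (κL : ZpExtension L 3) (hκL : κL.IsCyclotomic) : ClassicalMuVanishes κL := by
  classical
  -- `#G ≤ 8` and `[K : ℚ] = 4` give `K.fixingSubgroup = {1, s}`
  have hs_ne : s ≠ 1 := fun h => hs1 (by rw [h, map_one])
  have hcard8 := natCard_le_eight ρ hρ himg
  have hgt : 1 < Nat.card ↥K.fixingSubgroup :=
    (Subgroup.one_lt_card_iff_ne_bot _).mpr fun h => hs_ne (by rw [h] at hsK; exact Subgroup.mem_bot.mp hsK)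
  have hHcard : Nat.card ↥K.fixingSubgroup = 2 := by
    have h1 : Nat.card ↥K.fixingSubgroup = Module.finrank ↥K L := IsGalois.card_fixingSubgroup_eq_finrank K
    have h2 : Module.finrank ℚ ↥K * Module.finrank ↥K L = Module.finrank ℚ L := Module.finrank_mul_finrank ℚ ↥K L
    have h3 : Nat.card (L ≃ₐ[ℚ] L) = Module.finrank ℚ L := IsGalois.card_aut_eq_finrank ℚ L
    rw [hK4] at h2
    omega
  have hss : s * s = 1 := by
    have h := pow_card_eq_one' (G := ↥K.fixingSubgroup) (x := ⟨s, hsK⟩)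
    rw [hHcard] at h
    have h' : s ^ 2 = 1 := by simpa using congrArg Subtype.val h
    rwa [pow_two] at h'
  have hKfix : K.fixingSubgroup = Subgroup.zpowers s := by
    symm
    apply Subgroup.eq_of_le_of_card_ge ((Subgroup.zpowers_le).mpr hsK)
    rw [hHcard, Nat.card_zpowers, orderOf_eq_prime (p := 2) (by rw [pow_two]; exact hss) hs_ne]
  have hKeq : K = fixedField (Subgroup.zpowers s) := by
    rw [← hKfix]; exact (IsGalois.fixedField_fixingSubgroup K).symm
  have hμ' : ∀ κE : ZpExtension ↥(fixedField (Subgroup.zpowers s)) 3, κE.IsCyclotomic → ClassicalMuVanishes κE :=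
    forall_classicalMuVanishes_of_algEquiv (F := ℚ) (IntermediateField.equivOfEq hKeq) (by rw [hK4]; decide) hμ
  exact classicalMuVanishes_of_isCyclotomic_of_splitCartanNormalizer_three_fixedField hFW L ρ hρ himg hss hs1 hs2 hμ' κL
    hκL

end Literature.NumberTheory.IwasawaTheory

end
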